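import Summits.QuantumFields.YangMills.Theorems.BalabanUVNodesClustersCore
import Literature.MathematicalPhysics.QuantumFieldTheory.Balaban1983to89.B14NodeKnitTowerDatum

/-!
# DAG node N11 — [B14] `Dag.B14_main` ([Balaban1988Convergent] CMP **119** (1988) 243–285: Theorem 1 p. 262, with the Theorem of p. 245 and the
# ASSUMED operation 𝐑 of p. 244) IN THE ROUTE'S CURRENCY: the cluster stub `YMDAG.UVSplit.S_N11 Rec := AtRecord Rec Dag.B14_main` (K2 «FlowBounds»,
# `BalabanUVNodesClustersCore`) REDUCED, for every record predicate `Rec` binding its worlds to a Stage-₉ TOWER DATUM `T4DatumAssembly.datumOfTower F N M τ`,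
# to the three printed slots (S0) start · (S1ᵀ) Theorem p. 245 · (𝐑) p. 244 — by name from `B14NodeKnitTowerDatum`

Cell `pub-ymgap`, YM-PLAN Track A (HUMAN RULING D-0062), seat `pub-ymgap-dag-n11-a` (gen 4; -a = KNIT-BY-NAME; chair R420 ∕ R422 ∕ R424 ∕ R437 ∕ R439 ∕
R445).  The route «BalabanUVNodes» types every paper node as `AtRecord Rec X` over ONE record-predicate PARAMETER `Rec : RecordPred N` (NODE 00's notion,
definition first); N11's is `S_N11 Rec` (:189).  NODE 00's Stage ₉ datum of record is a TOWER DATUM (chair R437; seat dag-n23-a's `datumOfTower`, seat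
node00-def-T's `RepTowerOfRecord`, the successor's `Record9`).  This module says, once, what `S_N11 Rec` costs for any `Rec` whose worlds are bound to tower
data: at each run two space predicates `InS k` («the `k`-th carried representation lies in the index-`k` space of [III] §2, conditions and bounds included»)
and `InT k` («its renormalization transform lies in the corresponding space», p. 262) READ into the core's §2-form clause, and the slots (S0) `InS 0` under
the interval hypothesis, (S1ᵀ) `InS k → InT k` for `k < K` GIVEN the node's antecedents (THE THEOREM OF p. 245: [III] §1 for k = 0, §3 + Thm 2 for k ≥ 1),
(𝐑) `InT k → InS (k+1)` GIVEN the `rOperation` leaf ([III] p. 244: assumed; node N13's product) — `S_N11_of_towerData`; and the same in SLOT CURRENCY over the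
(2.18) slot families of record (`Node00.TexpAOfRecord`, `densityOfRepr`; node00-def-T's recursion `texpA (k+1) = Rstep (Tstep (texpA k))`) —
`S_N11_of_towerSlots`, with (𝐑) read ALONG the tower in `S_N11_of_towerSlots_along` (the form NODE 00's 𝐑-leaf pinned along the run's tower delivers, seat
dag-n13-a's `VOfTower`: there `S_N11` = (S0) + (S1ᵀ)).  No Stage-8 instance is stated (R445 (A)): `Rec` stays a parameter and the binding to a tower datum is
a displayed hypothesis, discharged by `rfl` at NODE 00's `Record9`.

HONEST FRAMING.  Bookkeeping by name (three compositions of `B14NodeKnitTowerDatum` with the cluster module's `AtRecord`); NO estimate of Bałaban's series is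
proved; (S1ᵀ) is a displayed hypothesis, (𝐑) the printed assumption of p. 244; N11 NOT discharged; counts unmoved.  One finite four-torus programme at fixed
ε per run; NOT ℝ⁴, NOT infinite volume, NOT OS, NOT a mass gap, NOT Clay.  Source: [III] = Balaban1988Convergent Thm 1 p. 262, Theorem p. 245, p. 244,
(2.18) p. 257, (3.24)–(3.25) p. 270; 𝐑 = Balaban1989LargeFieldI (0.3) p. 176.
-/

noncomputable section

open scoped BigOperators

namespace Summit.QuantumFields.YangMills.Theorems.BalabanUVNodesN11AtRecord

open Literature.MathematicalPhysics.QuantumFieldTheory.Balaban1983to89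
open Literature.MathematicalPhysics.QuantumFieldTheory.Balaban1983to89.T4Continuum (T4Family FiniteEpsData)
open Literature.MathematicalPhysics.QuantumFieldTheory.Balaban1983to89.DagBinding (WorldP leavesP)
open Literature.MathematicalPhysics.QuantumFieldTheory.Balaban1983to89.T4DatumAssembly (RGMachineCore datumOfTower)
open Literature.MathematicalPhysics.QuantumFieldTheory.Balaban1983to89.Node00 (avOfRecord Stage7Numerics SeqOfRecord chiSeqOfRecord TexpAOfRecord
  densityOfRepr)
open Literature.MathematicalPhysics.QuantumFieldTheory.Balaban1983to89.B14NodeKnitTowerDatum (b14_main_at_datumOfTower_of_propTower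
  b14_main_at_datumOfTower_slots b14_main_at_datumOfTower_slots_along)
open YMDAG.UVSplit (Datum RecordPred AtRecord S_N11)

variable {N : ℕ} [NeZero N] (Rec : RecordPred N)

/-- **`S_N11 Rec` OVER TOWER DATA, SPACE-PREDICATE FORM** ([Balaban1988Convergent] Thm 1 p. 262 with the Theorem of p. 245 and the assumed 𝐑 of p. 244): if
every `Rec`-world is bound to the construction of SOME tower datum `datumOfTower F N M τ` (`w.C = …`, NODE 00 Stage ₉) and supplies, at every run, two
ℕ-indexed space predicates with the reading into the machine core's §2-form clause and the slots (S0), (S1ᵀ), (𝐑), then N11 holds at every run of every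
world of record.  `B14NodeKnitTowerDatum.b14_main_at_datumOfTower_of_propTower` under `AtRecord`. [cite: Balaban1988Convergent, Thm 1 p.262; Theorem p.245; p.244] -/
theorem S_N11_of_towerData
    (h : ∀ (F : T4Family) (D : Datum F N) (w : WorldP), Rec F D w →
      ∃ (M : RGMachineCore F (YMDAG.UVSplit.SU N)) (τ : M.Tower (avOfRecord F N)),
        w.C = (datumOfTower F N M τ).C ∧ ∀ P : B12.RunParams, ∃ InS InT : ℕ → Prop,
          (∀ k, k ≤ P.K → InS k → M.Sect2Form P k) ∧
          ((leavesP w P).smallCouplings → InS 0) ∧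
          ((leavesP w P).b7 → (leavesP w P).b8 → (leavesP w P).b9 → (leavesP w P).b10 → (leavesP w P).b11 →
            (leavesP w P).smallCouplings → (leavesP w P).smallFieldInductive → (leavesP w P).flowControl →
              ∀ k, k < P.K → InS k → InT k) ∧
          ((leavesP w P).rOperation → ∀ k, k < P.K → InT k → InS (k + 1))) :
    S_N11 Rec := by
  intro F D w hw P
  obtain ⟨M, τ, hC, hP⟩ := h F D w hw
  obtain ⟨InS, InT, hS, h0, hT, hR⟩ := hP P
  exact b14_main_at_datumOfTower_of_propTower F N M τ w P hC InS InT hS h0 hT hR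

/-- **`S_N11 Rec` OVER TOWER DATA, SLOT CURRENCY** ([Balaban1988Convergent] Thm 1 p. 262, (2.18) p. 257, (3.24)–(3.25) p. 270, p. 244): every `Rec`-world is
bound to a tower datum whose densities at the run `P` are ASSEMBLED from a slot family `texpA P g k : s ↦ (𝐓_k e^{A_k})(s)` of the (2.18) representation of
record (`τ.ρ P k = densityOfRepr … texpA P g k`), built by `texpA P g (k+1) = Rstep k (Tstep k (texpA P g k))` (node00-def-T's recursion), with the core's clause
read as «assembled ∧ `Laws k` of the level-`k` slots»; slots (S0) `Laws 0 (texpA P g 0)`, (S1ᵀ) `Laws k (texpA P g k) → LawsT k (Tstep k (texpA P g k))` GIVEN the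
antecedents, (𝐑) `LawsT k f → Laws (k+1) (Rstep k f)` GIVEN the leaf.  `B14NodeKnitTowerDatum.b14_main_at_datumOfTower_slots` under `AtRecord`.
[cite: Balaban1988Convergent, Thm 1 p.262; Theorem p.245; (2.18) p.257; (3.24)–(3.25) p.270; p.244] -/
theorem S_N11_of_towerSlots
    (h : ∀ (F : T4Family) (D : Datum F N) (w : WorldP), Rec F D w →
      ∃ (M : RGMachineCore F (YMDAG.UVSplit.SU N)) (τ : M.Tower (avOfRecord F N)),
        w.C = (datumOfTower F N M τ).C ∧ ∀ P : B12.RunParams,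
          ∃ (ν : Stage7Numerics) (Mx : ℕ) (g : ℕ → ℝ) (texpA : TexpAOfRecord F N ν Mx)
            (Tstep : (k : ℕ) → (SeqOfRecord F ν Mx g P.K k → Density (F.P P.K) k (YMDAG.UVSplit.SU N)) →
              (SeqOfRecord F ν Mx g P.K (k + 1) → Density (F.P P.K) (k + 1) (YMDAG.UVSplit.SU N)))
            (Rstep : (k : ℕ) → (SeqOfRecord F ν Mx g P.K (k + 1) → Density (F.P P.K) (k + 1) (YMDAG.UVSplit.SU N)) →
              (SeqOfRecord F ν Mx g P.K (k + 1) → Density (F.P P.K) (k + 1) (YMDAG.UVSplit.SU N)))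
            (Laws : (k : ℕ) → (SeqOfRecord F ν Mx g P.K k → Density (F.P P.K) k (YMDAG.UVSplit.SU N)) → Prop)
            (LawsT : (k : ℕ) → (SeqOfRecord F ν Mx g P.K (k + 1) → Density (F.P P.K) (k + 1) (YMDAG.UVSplit.SU N)) → Prop),
            (∀ k, texpA P g (k + 1) = Rstep k (Tstep k (texpA P g k))) ∧
            (∀ k, τ.ρ P k = densityOfRepr F N ν Mx texpA P g k) ∧
            (∀ k, k ≤ P.K → (M.Sect2Form P k ↔ (τ.ρ P k = densityOfRepr F N ν Mx texpA P g k ∧ Laws k (texpA P g k)))) ∧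
            ((leavesP w P).smallCouplings → Laws 0 (texpA P g 0)) ∧
            ((leavesP w P).b7 → (leavesP w P).b8 → (leavesP w P).b9 → (leavesP w P).b10 → (leavesP w P).b11 →
              (leavesP w P).smallCouplings → (leavesP w P).smallFieldInductive → (leavesP w P).flowControl →
                ∀ k, k < P.K → Laws k (texpA P g k) → LawsT k (Tstep k (texpA P g k))) ∧
            ((leavesP w P).rOperation → ∀ k, k < P.K →
              ∀ f : SeqOfRecord F ν Mx g P.K (k + 1) → Density (F.P P.K) (k + 1) (YMDAG.UVSplit.SU N),
                LawsT k f → Laws (k + 1) (Rstep k f))) :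
    S_N11 Rec := by
  intro F D w hw P
  obtain ⟨M, τ, hC, hP⟩ := h F D w hw
  obtain ⟨ν, Mx, g, texpA, Tstep, Rstep, Laws, LawsT, hsucc, hρ, hS9, h0, hT, hR⟩ := hP P
  exact b14_main_at_datumOfTower_slots F N M τ w P ν Mx g texpA Tstep Rstep Laws LawsT hC hsucc hρ hS9 h0 hT hR

/-- **`S_N11 Rec` OVER TOWER DATA, SLOT CURRENCY, (𝐑) READ ALONG THE TOWER** (`LawsT k (Tstep k (texpA P g k)) → Laws (k+1) (texpA P g (k+1))` — the form
NODE 00's 𝐑-leaf pinned along the run's tower delivers; seat dag-n13-a's `VOfTower`): at such records `S_N11` = (S0) + (S1ᵀ).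
`B14NodeKnitTowerDatum.b14_main_at_datumOfTower_slots_along` under `AtRecord`. [cite: Balaban1988Convergent, Thm 1 p.262; Theorem p.245; p.244] -/
theorem S_N11_of_towerSlots_along
    (h : ∀ (F : T4Family) (D : Datum F N) (w : WorldP), Rec F D w →
      ∃ (M : RGMachineCore F (YMDAG.UVSplit.SU N)) (τ : M.Tower (avOfRecord F N)),
        w.C = (datumOfTower F N M τ).C ∧ ∀ P : B12.RunParams,
          ∃ (ν : Stage7Numerics) (Mx : ℕ) (g : ℕ → ℝ) (texpA : TexpAOfRecord F N ν Mx)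
            (Tstep : (k : ℕ) → (SeqOfRecord F ν Mx g P.K k → Density (F.P P.K) k (YMDAG.UVSplit.SU N)) →
              (SeqOfRecord F ν Mx g P.K (k + 1) → Density (F.P P.K) (k + 1) (YMDAG.UVSplit.SU N)))
            (Laws : (k : ℕ) → (SeqOfRecord F ν Mx g P.K k → Density (F.P P.K) k (YMDAG.UVSplit.SU N)) → Prop)
            (LawsT : (k : ℕ) → (SeqOfRecord F ν Mx g P.K (k + 1) → Density (F.P P.K) (k + 1) (YMDAG.UVSplit.SU N)) → Prop),
            (∀ k, τ.ρ P k = densityOfRepr F N ν Mx texpA P g k) ∧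
            (∀ k, k ≤ P.K → (M.Sect2Form P k ↔ (τ.ρ P k = densityOfRepr F N ν Mx texpA P g k ∧ Laws k (texpA P g k)))) ∧
            ((leavesP w P).smallCouplings → Laws 0 (texpA P g 0)) ∧
            ((leavesP w P).b7 → (leavesP w P).b8 → (leavesP w P).b9 → (leavesP w P).b10 → (leavesP w P).b11 →
              (leavesP w P).smallCouplings → (leavesP w P).smallFieldInductive → (leavesP w P).flowControl →
                ∀ k, k < P.K → Laws k (texpA P g k) → LawsT k (Tstep k (texpA P g k))) ∧
            ((leavesP w P).rOperation → ∀ k, k < P.K →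
              LawsT k (Tstep k (texpA P g k)) → Laws (k + 1) (texpA P g (k + 1)))) :
    S_N11 Rec := by
  intro F D w hw P
  obtain ⟨M, τ, hC, hP⟩ := h F D w hw
  obtain ⟨ν, Mx, g, texpA, Tstep, Laws, LawsT, hρ, hS9, h0, hT, hR⟩ := hP P
  exact b14_main_at_datumOfTower_slots_along F N M τ w P ν Mx g texpA Tstep Laws LawsT hC hρ hS9 h0 hT hR

end Summit.QuantumFields.YangMills.Theorems.BalabanUVNodesN11AtRecord

end
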